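import Summits.Ventures.HSemireg.LineLawRamifiedCapture
import Summits.Ventures.HSemireg.LineLawNeverPairs
import HarnessLib

/-!
# Venture HSemireg — LINE LAW, the CONVERSE in kernel form: from the class relations «[𝔯₁] = [𝔯₂]», «[𝔭] = [𝔯₁][𝔯₂]» and «p not a norm»
# to an explicit coupling anomaly at the weight pair `(1, p)` (ENGINE-W code B, card LINE-LAW-B.md §17 (a)(b))

HONEST FRAMING. Lean index of the computation cell `pub-hsemireg`, widening group ENGINE-W (code B, seat `engine-w-2`, gen 11). RING ∕ IDEAL
ARITHMETIC in Mathlib's `ℤ√m` through the tree's Cox §7 library (`ZsqrtdFormClassGroupProofs.span_pair_mul_span_pair_neg` = Cox (7.6)) and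
this lineage's files `LineLawPrincipalGenus` ∕ `LineLawRamifiedCapture` ∕ `LineLawNeverPairs` (imported). THEOREM CF⁶ and «reached weight
lines» enter BY VALUE. No abelian variety, sheaf, `Ext` group or semiregularity map is constructed; nothing here says that HC, HC_CM or
HC_AV holds. Theorems only (0 `def`, 0 named fact, 0 `sorry`).

SOURCE (card `widen/ENGINE-W/out/probe4/LINE-LAW-B.md` v1.16 §17). THEOREM §17 (b): if `Cl(ℤ[√m])` (`m < 0`) has a class `C` with `C² ≠ 1`,
primes `r₁, r₂` in `C` and `p` in `C²` give `s = r₁r₂` and `p·s` as norms of primitive elements while `p` is not one, so (§17 (a)) the pair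
`(1, p)` at `T = p·s` is «law yes, NO common A». KERNEL FORM, with the class relations stated as Cox's (7.8) ideal equations
`(x₁)·𝔯₁ = (y₁)·𝔯₂` and `(x₀)·𝔭 = (y₀)·𝔯₁𝔯₂` (`xᵢ, yᵢ ≠ 0`) for the ideals `𝔯ᵢ = (rᵢ, −bᵢ + l)`, `𝔭 = (p, −b + l)` of primitive forms of
discriminant `4m`, and with «`p` is not of the form `x² − m y²`» (⟺ `𝔭` not principal) as the non-triviality hypothesis; the EXISTENCE of
such primes for a non-2-torsion class group (Dirichlet ∕ Chebotarev, Cox Thm. 9.12) stays BY VALUE, exactly as in the tree's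
`ConvenientNumbers.not_isConvenientNumber_of_sq_ne_one`.

WHAT THE KERNEL HOLDS: `crt_three` (CRT for three pairwise coprime moduli), `root_mod_prod` (a common root of `m` modulo `r₁ r₂` ∕ `p r₁ r₂`
from the forms' roots), **`principal_norm_of_rel`** (`(x)·(n, −A + l) = (t)` with `x ≠ 0` ⇒ a primitive `z` with `N z = n`, `z ∣ A − l`),
**`norm_s_of_classes_eq`** (`[𝔯₁] = [𝔯₂]` ⇒ `r₁ r₂` is a primitive norm), **`norm_ps_of_class_rel`** (`[𝔭] = [𝔯₁][𝔯₂]` ⇒ `p r₁ r₂` is a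
primitive norm), and the assembled **`lineLaw_fails_of_class_relations`**: together with `p` not a norm, the pair `(1, p)` at
`T = p r₁ r₂` is representable on both weights yet admits no common `A` — the §17 converse, kernel modulo the existence of the primes.
-/

open scoped nonZeroDivisors

namespace Summit.Ventures.HSemireg.LineLawConverse

open Literature.NumberTheory.QuadraticFields.Quadratic.BinQF (span_pair_mul_span_pair_neg)
open Summit.Ventures.HSemireg.LineLawPrincipalGenus Summit.Ventures.HSemireg.LineLawRamifiedCapture
open Summit.Ventures.HSemireg.LineLawNeverPairs

/-- CRT for three pairwise coprime moduli (Bezout form). [kernel] -/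
theorem crt_three {n₁ n₂ n₃ : ℤ} (h12 : IsCoprime n₁ n₂) (h3 : IsCoprime n₃ (n₁ * n₂)) (A₁ A₂ A₃ : ℤ) :
    ∃ A : ℤ, n₁ ∣ A - A₁ ∧ n₂ ∣ A - A₂ ∧ n₃ ∣ A - A₃ := by
  obtain ⟨B, hB1, hB2⟩ := crt_pair h12 A₁ A₂
  obtain ⟨A, hA3, hAB⟩ := crt_pair h3 A₃ B
  refine ⟨A, ?_, ?_, hA3⟩
  · have e : A - A₁ = (A - B) + (B - A₁) := by ring
    rw [e]; exact dvd_add ((dvd_mul_right n₁ n₂).trans hAB) hB1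
  · have e : A - A₂ = (A - B) + (B - A₂) := by ring
    rw [e]; exact dvd_add ((dvd_mul_left n₂ n₁).trans hAB) hB2

/-- A root `b` of `m` modulo `n` (`b² − n c = m`) transported along `n ∣ A − b` gives `n ∣ A² − m`. [kernel] -/
theorem dvd_sq_sub_of_root {m n b c A : ℤ} (hb : b ^ 2 - n * c = m) (hA : n ∣ A - b) : n ∣ A ^ 2 - m :=
  root_of_congr hA ⟨c, by linear_combination hb⟩

/-- **From a Cox-(7.8) relation to an element**: if `(x)·(n, −A + l) = (t)` with `x ≠ 0`, `n ≠ 0`, `n ∣ A² − m` (`m < 0`), then some primitive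
`z ∈ ℤ√m` with `N z = n` divides `A − l` (cancellation in a domain + the parent's §2). [kernel] -/
theorem principal_norm_of_rel {m : ℤ} (hm : m < 0) {n A : ℤ} (hn : 0 < n) (hA : n ∣ A ^ 2 - m) {x t : ℤ√m} (hx : x ≠ 0)
    (h : Ideal.span {x} * Ideal.span {(n : ℤ√m), ⟨-A, 1⟩} = Ideal.span {t}) :
    ∃ z : ℤ√m, z.norm = n ∧ z ∣ (⟨A, -1⟩ : ℤ√m) ∧ IsCoprime z.re z.im := by
  haveI : IsDomain (ℤ√m) := Zsqrtd.isDomain_of_neg hm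
  obtain ⟨c, hc⟩ := hA
  obtain ⟨g, hg⟩ := exists_eq_span_singleton_of_span_singleton_mul hx h
  obtain ⟨hdvd, hnorm⟩ := dvd_and_norm_of_span_eq hn.ne' (show A ^ 2 - n * c = m by linear_combination hc) hg
  have h0 := Zsqrtd.norm_nonneg hm.le g
  refine ⟨g, ?_, hdvd, ?_⟩
  · rcases hnorm with h' | h'
    · exact h'
    · omega
  · obtain ⟨w, hw⟩ := hdvd
    exact isCoprime_of_dvd hw.symm

/-- **`[𝔯₁] = [𝔯₂]` makes `r₁ r₂` a primitive norm.** Ideals `𝔯ᵢ = (rᵢ, −bᵢ + l)` of primitive forms `(rᵢ, 2bᵢ, cᵢ)` of discriminant `4m`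
(`m < 0`, `rᵢ > 0` coprime, `(r₂, 2b₂, c₂)` primitive), related by `(x₁)·𝔯₁ = (y₁)·𝔯₂` with `x₁ ≠ 0`: then `𝔯₁·𝔯̄₂ = (z)` with `N z = r₁ r₂`,
`z` primitive (multiply the relation by `𝔯̄₂`, use Cox (7.6) `𝔯₂𝔯̄₂ = (r₂)`, write `𝔯₁𝔯̄₂ = (r₁r₂, −A + l)` for a CRT root `A`, cancel). [kernel] -/
theorem norm_s_of_classes_eq {m : ℤ} (hm : m < 0) {r₁ b₁ c₁ r₂ b₂ c₂ : ℤ} (hr₁ : 0 < r₁) (hr₂ : 0 < r₂)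
    (h1 : b₁ ^ 2 - r₁ * c₁ = m) (h2 : b₂ ^ 2 - r₂ * c₂ = m) (h2prim : ∃ x y z : ℤ, x * r₂ + y * (2 * b₂) + z * c₂ = 1)
    (hcop : IsCoprime r₁ r₂) {x₁ y₁ : ℤ√m} (hx₁ : x₁ ≠ 0)
    (hC : Ideal.span {x₁} * Ideal.span {(r₁ : ℤ√m), ⟨-b₁, 1⟩} = Ideal.span {y₁} * Ideal.span {(r₂ : ℤ√m), ⟨-b₂, 1⟩}) :
    ∃ z : ℤ√m, z.norm = r₁ * r₂ ∧ IsCoprime z.re z.im := by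
  -- a common root: A ≡ b₁ (mod r₁), A ≡ −b₂ (mod r₂)
  obtain ⟨A, hA1, hA2⟩ := crt_pair hcop b₁ (-b₂)
  have e1 : Ideal.span {(r₁ : ℤ√m), ⟨-b₁, 1⟩} = Ideal.span {(r₁ : ℤ√m), ⟨-A, 1⟩} :=
    span_pair_congr (dvd_sub_comm.mp hA1)
  have e2 : Ideal.span {(r₂ : ℤ√m), ⟨-(-b₂), 1⟩} = Ideal.span {(r₂ : ℤ√m), ⟨-A, 1⟩} :=
    span_pair_congr (dvd_sub_comm.mp hA2)
  have hconj : Ideal.span {(r₂ : ℤ√m), ⟨-b₂, 1⟩} * Ideal.span {(r₂ : ℤ√m), ⟨-(-b₂), 1⟩} = Ideal.span {(r₂ : ℤ√m)} :=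
    span_pair_mul_span_pair_neg h2 h2prim
  have hprod : Ideal.span {(r₁ : ℤ√m), ⟨-A, 1⟩} * Ideal.span {(r₂ : ℤ√m), ⟨-A, 1⟩} =
      Ideal.span {((r₁ * r₂ : ℤ) : ℤ√m), ⟨-A, 1⟩} := span_pair_mul_span_pair_coprime hcop
  -- multiply the class relation by 𝔯̄₂
  have key : Ideal.span {x₁} * Ideal.span {((r₁ * r₂ : ℤ) : ℤ√m), ⟨-A, 1⟩} = Ideal.span {y₁ * (r₂ : ℤ√m)} := by
    rw [← hprod, ← e1, ← e2, ← mul_assoc, hC, mul_assoc, hconj, Ideal.span_singleton_mul_span_singleton]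
  have hA : (r₁ * r₂ : ℤ) ∣ A ^ 2 - m :=
    IsCoprime.mul_dvd hcop (dvd_sq_sub_of_root h1 hA1) (dvd_sq_sub_of_root (b := -b₂) (c := c₂) (by linear_combination h2) hA2)
  obtain ⟨z, hz, -, hzc⟩ := principal_norm_of_rel hm (mul_pos hr₁ hr₂) hA hx₁ key
  exact ⟨z, hz, hzc⟩

/-- **`[𝔭] = [𝔯₁][𝔯₂]` makes `p r₁ r₂` a primitive norm.** With `𝔭 = (p, −b + l)` of a PRIMITIVE form `(p, 2b, c_b)` of discriminant `4m` and
`𝔯ᵢ` as above (`p, r₁, r₂` pairwise coprime, `m < 0`), the relation `(x₀)·𝔭 = (y₀)·𝔯₁𝔯₂` with `y₀ ≠ 0` gives `𝔭̄·𝔯₁·𝔯₂ = (z)` with `N z = p r₁ r₂`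
(multiply by `𝔭̄`, Cox (7.6) `𝔭𝔭̄ = (p)`, CRT root, product formula twice, cancel). [kernel] -/
theorem norm_ps_of_class_rel {m : ℤ} (hm : m < 0) {p b cb r₁ b₁ c₁ r₂ b₂ c₂ : ℤ} (hp : 0 < p) (hr₁ : 0 < r₁) (hr₂ : 0 < r₂)
    (hpb : b ^ 2 - p * cb = m) (h1 : b₁ ^ 2 - r₁ * c₁ = m) (h2 : b₂ ^ 2 - r₂ * c₂ = m)
    (hpprim : ∃ x y z : ℤ, x * p + y * (2 * b) + z * cb = 1)
    (hcop : IsCoprime r₁ r₂) (hcopp : IsCoprime p (r₁ * r₂)) {x₀ y₀ : ℤ√m} (hy₀ : y₀ ≠ 0)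
    (hC2 : Ideal.span {x₀} * Ideal.span {(p : ℤ√m), ⟨-b, 1⟩} =
      Ideal.span {y₀} * (Ideal.span {(r₁ : ℤ√m), ⟨-b₁, 1⟩} * Ideal.span {(r₂ : ℤ√m), ⟨-b₂, 1⟩})) :
    ∃ z : ℤ√m, z.norm = p * (r₁ * r₂) ∧ IsCoprime z.re z.im := by
  -- a common root: A ≡ b₁ (r₁), A ≡ b₂ (r₂), A ≡ −b (p)
  obtain ⟨A, hA1, hA2, hA3⟩ := crt_three hcop hcopp b₁ b₂ (-b)
  have e1 : Ideal.span {(r₁ : ℤ√m), ⟨-b₁, 1⟩} = Ideal.span {(r₁ : ℤ√m), ⟨-A, 1⟩} :=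
    span_pair_congr (dvd_sub_comm.mp hA1)
  have e2 : Ideal.span {(r₂ : ℤ√m), ⟨-b₂, 1⟩} = Ideal.span {(r₂ : ℤ√m), ⟨-A, 1⟩} :=
    span_pair_congr (dvd_sub_comm.mp hA2)
  have e3 : Ideal.span {(p : ℤ√m), ⟨-(-b), 1⟩} = Ideal.span {(p : ℤ√m), ⟨-A, 1⟩} :=
    span_pair_congr (dvd_sub_comm.mp hA3)
  have hconj : Ideal.span {(p : ℤ√m), ⟨-b, 1⟩} * Ideal.span {(p : ℤ√m), ⟨-(-b), 1⟩} = Ideal.span {(p : ℤ√m)} :=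
    span_pair_mul_span_pair_neg hpb hpprim
  have hprod12 : Ideal.span {(r₁ : ℤ√m), ⟨-A, 1⟩} * Ideal.span {(r₂ : ℤ√m), ⟨-A, 1⟩} =
      Ideal.span {((r₁ * r₂ : ℤ) : ℤ√m), ⟨-A, 1⟩} := span_pair_mul_span_pair_coprime hcop
  have hprod3 : Ideal.span {(p : ℤ√m), ⟨-A, 1⟩} * Ideal.span {((r₁ * r₂ : ℤ) : ℤ√m), ⟨-A, 1⟩} =
      Ideal.span {((p * (r₁ * r₂) : ℤ) : ℤ√m), ⟨-A, 1⟩} := span_pair_mul_span_pair_coprime hcopp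
  -- multiply the relation by 𝔭̄ and rearrange
  have key : Ideal.span {y₀} * Ideal.span {((p * (r₁ * r₂) : ℤ) : ℤ√m), ⟨-A, 1⟩} = Ideal.span {x₀ * (p : ℤ√m)} := by
    have h' : Ideal.span {x₀} * Ideal.span {(p : ℤ√m), ⟨-b, 1⟩} * Ideal.span {(p : ℤ√m), ⟨-(-b), 1⟩} =
        Ideal.span {y₀} * (Ideal.span {(r₁ : ℤ√m), ⟨-b₁, 1⟩} * Ideal.span {(r₂ : ℤ√m), ⟨-b₂, 1⟩}) *
          Ideal.span {(p : ℤ√m), ⟨-(-b), 1⟩} := by rw [hC2]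
    rw [mul_assoc, hconj, Ideal.span_singleton_mul_span_singleton] at h'
    rw [← hprod3, ← hprod12, ← e1, ← e2, ← e3, h']
    ring
  have hA : (p * (r₁ * r₂) : ℤ) ∣ A ^ 2 - m :=
    IsCoprime.mul_dvd hcopp (dvd_sq_sub_of_root (b := -b) (c := cb) (by linear_combination hpb) hA3)
      (IsCoprime.mul_dvd hcop (dvd_sq_sub_of_root h1 hA1) (dvd_sq_sub_of_root h2 hA2))
  obtain ⟨z, hz, -, hzc⟩ := principal_norm_of_rel hm (mul_pos hp (mul_pos hr₁ hr₂)) hA hy₀ key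
  exact ⟨z, hz, hzc⟩

/-- **THE CONVERSE, ASSEMBLED (card §17 (a)+(b), kernel modulo the existence of the primes).** `m < 0`; primitive forms `(p, 2b, c_b)`,
`(r₁, 2b₁, c₁)`, `(r₂, 2b₂, c₂)` of discriminant `4m` with `p, r₁, r₂ > 0` pairwise coprime; their ideals satisfy Cox's class relations
`(x₁)·𝔯₁ = (y₁)·𝔯₂` («`[𝔯₁] = [𝔯₂] =: C`») and `(x₀)·𝔭 = (y₀)·𝔯₁𝔯₂` («`[𝔭] = C²`») with `x₁, y₀ ≠ 0`; and `p` is NOT of the form `x² − m y²`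
(«`C² ≠ 1`»). THEN with `s = r₁ r₂`: `s` and `p·s` are norms of primitive elements of `ℤ[√m]` (the weight pair `(1, p)` at `T = p s` passes the
simple law) but NO `A` has `z₁, z₂ ∣ A − l` with `N z₁ = p s`, `N z₂ = s` (the line is not reached): a coupling anomaly. By value: such primes
exist whenever `Cl(4m)` is not 2-torsion (Cox Thm. 9.12), so the simple LINE LAW characterises one class per genus (card §17 (c)). [kernel] -/
theorem lineLaw_fails_of_class_relations {m : ℤ} (hm : m < 0) {p b cb r₁ b₁ c₁ r₂ b₂ c₂ : ℤ}
    (hp : 0 < p) (hr₁ : 0 < r₁) (hr₂ : 0 < r₂)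
    (hpb : b ^ 2 - p * cb = m) (h1 : b₁ ^ 2 - r₁ * c₁ = m) (h2 : b₂ ^ 2 - r₂ * c₂ = m)
    (hpprim : ∃ x y z : ℤ, x * p + y * (2 * b) + z * cb = 1) (h2prim : ∃ x y z : ℤ, x * r₂ + y * (2 * b₂) + z * c₂ = 1)
    (hcop : IsCoprime r₁ r₂) (hcopp : IsCoprime p (r₁ * r₂))
    {x₀ y₀ x₁ y₁ : ℤ√m} (hy₀ : y₀ ≠ 0) (hx₁ : x₁ ≠ 0)
    (hC : Ideal.span {x₁} * Ideal.span {(r₁ : ℤ√m), ⟨-b₁, 1⟩} = Ideal.span {y₁} * Ideal.span {(r₂ : ℤ√m), ⟨-b₂, 1⟩})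
    (hC2 : Ideal.span {x₀} * Ideal.span {(p : ℤ√m), ⟨-b, 1⟩} =
      Ideal.span {y₀} * (Ideal.span {(r₁ : ℤ√m), ⟨-b₁, 1⟩} * Ideal.span {(r₂ : ℤ√m), ⟨-b₂, 1⟩}))
    (hnot : ∀ x y : ℤ, x ^ 2 - m * y ^ 2 ≠ p) :
    (∃ z : ℤ√m, z.norm = r₁ * r₂ ∧ IsCoprime z.re z.im) ∧
    (∃ z : ℤ√m, z.norm = p * (r₁ * r₂) ∧ IsCoprime z.re z.im) ∧
    (∀ (A : ℤ) (z₁ w₁ z₂ w₂ : ℤ√m), z₁ * w₁ = ⟨A, -1⟩ → z₂ * w₂ = ⟨A, -1⟩ →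
        z₁.norm = p * (r₁ * r₂) → z₂.norm = r₁ * r₂ → False) :=
  ⟨norm_s_of_classes_eq hm hr₁ hr₂ h1 h2 h2prim hcop hx₁ hC,
   norm_ps_of_class_rel hm hp hr₁ hr₂ hpb h1 h2 hpprim hcop hcopp hy₀ hC2,
   fun _ _ _ _ _ e1 e2 n1 n2 => never_pair_of_not_norm hnot (mul_pos hr₁ hr₂).ne' e1 e2 n1 n2⟩

end Summit.Ventures.HSemireg.LineLawConverse
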